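import Literature.AnabelianGeometry.EtaleTheta.ThetaKummerInversionInnerLiftsNoGo
import HarnessLib

/-!
# The function-level [EtTh] Prop 1.4 (ii) package at the χ-model: the OTHER SIGN (`ιFn Θ̈ = +Θ̈`, the `μ_−`-pointed
# convention) is dead too, for every vertex-`0` inner lift, once the deck identity holds (proof-only)

S. Mochizuki, *The étale theta function …*, Publ. RIMS **45** (2009) [EtTh]: Prop 1.4 (ii) p. 22 («`Θ̈(Ü⁻¹) = −Θ̈(Ü)`»,
«`Θ̈(−Ü) = −Θ̈(Ü)`» — hence `Θ̈(−Ü⁻¹) = +Θ̈(Ü)` for the lift `Ü ↦ −Ü⁻¹` fixing the 4-torsion points `±√−1`);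
*Inter-universal Teichmüller theory II*, Rmk 1.4.1 (ii) p. 28 (the `μ_−`-POINTED inversion: `ι_Ÿ` composed with
`Gal(Ÿ/Y)`). Classical here. [cite: MochizukiEtTh2009, Prop 1.4 (ii) p.22]

abc-iut cell, layer L2, seat abc-iut-w5-d125 (gen 8); PROOF-ONLY (NO definition, NO `Prop` fact, NO instance; D-0067).
Companion of `ThetaKummerInversionInnerLiftsNoGo.lean` (p469482). The two printed lifts of the inversion of `X` to `Ÿ`
differ by the deck transformation `Ü ↦ −Ü` and pull `Θ̈` back to `−Θ̈` resp. `+Θ̈`. The typed L6 binder is `hιθ :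
ιFn Θ̈ = const(−1)·Θ̈`; THIS FILE shows that re-typing it with the other sign does not rescue non-vacuity at `modelχ`:

* §1 `ThetaKummerInput.exists_package_conj_deck_of_exists_packagePlus` (GENERIC): under the deck identity `hdeck`
  (`ε • Θ̈ = const(−1)·Θ̈` for `ε ∈ Π^tp_Y ∖ Π^tp_Ÿ`), a SIGN-`+1` package `{ιFn, hιFn, hΛ, ιFn Θ̈ = Θ̈}` for `ι` transports
  along conjugation by a geometric deck element `ε` (`aug ε = 1`) to a SIGN-`−1` package for `Ad(ε) ∘ ι` (`ιFn' := ε • ιFn`).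
* §2 `SettingModel.not_exists_packagePlus_modelχ_innerLift_of_deck` — at `modelχ`, for EVERY `γ ∈ Γ` of degree `0`,
  every `ι'` agreeing pointwise with `Ad(inl γ) ∘ ι`, and every `T` with injective `Λ(Fn) → Δ_Θ`, `ConstCompat kummerDataχ`
  AND `hdeck`: NO sign-`+1` package either (transport by `ε := inl b` to the vertex-`0` lift `Ad(inl(b·γ)) ∘ ι` with sign
  `−1`, killed by `not_exists_package_modelχ_innerLift_of_constCompat`). Mechanism in print's terms: `hdeck` forces the
  `Ü`-winding of `Θ̈` on `Π^tp_Ÿ` to be ODD, while a sign-`+1` lift fixing a Galois section forces it EVEN through the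
  half-twisted fixed sections.
CENSUS SENTENCE (model design, numbers not a side): at `modelχ` the quadruple {genuine constants, `hdeck`, `hιFn ∧ hΛ`,
`ιFn Θ̈ = ±Θ̈`} is unsatisfiable for BOTH signs and EVERY vertex-`0` inner lift of the inversion of record.

HONEST FRAMING: classical group theory over the cell's typed interface and its SEMI-SYNTHETIC χ-model (consistency
evidence only); nothing disputed is asserted; no side is taken on [IUTchIII] Cor 3.12; typed ≠ proved.
-/

noncomputable section

namespace Literature.AnabelianGeometry.EtaleTheta

open Literature.AnabelianGeometry.SemiGraphs

/-! ### §1. Sign flip along a deck element (generic) -/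

namespace ThetaSetting

namespace ThetaKummerInput

variable {p : ℕ} [Fact p.Prime] {D : ThetaSetting p} (T : D.ThetaKummerInput)

/-- **SIGN FLIP ALONG A DECK ELEMENT.** Let `ε ∈ Π^tp_Y ∖ Π^tp_Ÿ` be geometric (`aug ε = 1`) and let `ι'` agree pointwise
with `Ad(ε) ∘ ι`. Under the deck identity `hdeck`, a sign-`+1` package for `ι` (`ιFn Θ̈ = Θ̈`) yields a sign-`−1` package
for `ι'` (`ιFn' := ε • ιFn`, `ιFn' Θ̈ = ε • Θ̈ = const(−1)·Θ̈`); `ε` acts trivially on `Λ(Fn)` (needs `Λ(Fn) → Δ_Θ`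
injective). [cite: MochizukiEtTh2009, Prop 1.4 (ii) p.22] -/
theorem exists_package_conj_deck_of_exists_packagePlus (hinj : Function.Injective T.coeff.hom) {ε : D.PiTemp}
    (hεY : ε ∈ D.GtpY) (hεdd : ε ∉ D.GtpYdd) (hεΔ : D.aug ε = 1)
    (hdeck : ∀ e : D.PiTemp, e ∈ D.GtpY → e ∉ D.GtpYdd → e • T.theta = T.const (-1) * T.theta)
    (ι ι' : D.PiTemp ≃ₜ* D.PiTemp) (hι' : ∀ g, ι' g = ε * ι g * ε⁻¹)
    (h : ∃ ιFn : T.Fn →* T.Fn, (∀ (g : D.PiTemp) (f : T.Fn), ιFn (g • f) = ι g • ιFn f) ∧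
      (∀ ζ : cyclotome T.Fn, cyclotome.map ιFn ζ = ζ) ∧ ιFn T.theta = T.theta) :
    ∃ ιFn : T.Fn →* T.Fn, (∀ (g : D.PiTemp) (f : T.Fn), ιFn (g • f) = ι' g • ιFn f) ∧
      (∀ ζ : cyclotome T.Fn, cyclotome.map ιFn ζ = ζ) ∧ ιFn T.theta = T.const (-1) * T.theta := by
  obtain ⟨ιFn, hιFn, hΛ, hιθ⟩ := h
  refine ⟨(MulDistribMulAction.toMonoidHom T.Fn ε).comp ιFn, fun g f => ?_, fun ζ => ?_, ?_⟩
  · rw [MonoidHom.comp_apply, MulDistribMulAction.toMonoidHom_apply, MonoidHom.comp_apply,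
      MulDistribMulAction.toMonoidHom_apply, hιFn, hι', smul_smul, smul_smul, inv_mul_cancel_right]
  · have hζ := T.smul_cyclotome_eq_self_of_aug_eq_one hinj hεΔ ζ
    apply Subtype.ext
    funext n
    have h1 := congrArg (fun ξ : cyclotome T.Fn => (ξ : ℕ+ → T.Fn) n) (hΛ ζ)
    have h2 := congrArg (fun ξ : cyclotome T.Fn => (ξ : ℕ+ → T.Fn) n) hζ
    simp only [cyclotome.map_apply, cyclotome.smul_apply] at h1 h2
    rw [cyclotome.map_apply, MonoidHom.comp_apply, MulDistribMulAction.toMonoidHom_apply, h1, h2]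
  · rw [MonoidHom.comp_apply, MulDistribMulAction.toMonoidHom_apply, hιθ, hdeck ε hεY hεdd]

end ThetaKummerInput

end ThetaSetting

/-! ### §2. At the χ-model: the sign-`+1` package is dead for every vertex-`0` inner lift (given `hdeck`) -/

namespace SettingModel

open Literature.AnabelianGeometry.AbsoluteAnabelian

variable (p : ℕ) [Fact p.Prime]

/-- The basic deck element `inl b = inl b^{η(1)}` of the χ-model lies in `Π^tp_Y` but NOT in `Π^tp_Ÿ` (odd `y`-coordinate).
[cite: MochizukiEtTh2009, §1 p.17] -/
theorem inl_bPowGfp_eta_one_mem_GtpY_not_mem_GtpYdd :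
    (SemidirectProduct.inl (bPowGfp (ZHatLevel.eta 1)) : PiTpχ p) ∈ (ThetaSetting.modelχ p).GtpY ∧
      (SemidirectProduct.inl (bPowGfp (ZHatLevel.eta 1)) : PiTpχ p) ∉ (ThetaSetting.modelχ p).GtpYdd := by
  refine ⟨(mem_GtpY_modelχ_iff p _).mpr (by rw [SemidirectProduct.left_inl, gfpSnd_bPowGfp]), fun h => ?_⟩
  rw [GtpYdd_modelχ, mem_YNχ_two_iff, SemidirectProduct.left_inl, bPowGfp_mem_dY_iff, ZHatLevel.level_eta] at h
  exact absurd h (by decide)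

/-- **THE SIGN-`+1` PACKAGE IS DEAD TOO (every vertex-`0` inner lift, given `hdeck`).** At `modelχ`, for every `γ ∈ Γ` of
degree `0`, every `ι'` agreeing pointwise with `Ad(inl γ) ∘ ι` (`ι` the inversion of record), and every theta-Kummer input
`T` with injective `Λ(Fn) → Δ_Θ`, `ConstCompat kummerDataχ` and the deck identity, there is NO `ιFn` with
`hιFn ∧ hΛ ∧ ιFn Θ̈ = Θ̈`: conjugating by the deck element `inl b` gives a sign-`−1` package for the vertex-`0` lift
`Ad(inl(b·γ)) ∘ ι`, excluded by `not_exists_package_modelχ_innerLift_of_constCompat`.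
[cite: MochizukiEtTh2009, Prop 1.4 (ii) p.22] -/
theorem not_exists_packagePlus_modelχ_innerLift_of_deck (γ : Gfp)
    (hγ : (SemidirectProduct.inl γ : PiTpχ p) ∈ (ThetaSetting.modelχ p).GtpY)
    (T : (ThetaSetting.modelχ p).ThetaKummerInput) (hinj : letI := T.instAction; Function.Injective T.coeff.hom)
    (hcc : T.ConstCompat (kummerDataχ p))
    (hdeck : letI := T.instAction; ∀ e : (ThetaSetting.modelχ p).PiTemp, e ∈ (ThetaSetting.modelχ p).GtpY →
      e ∉ (ThetaSetting.modelχ p).GtpYdd → e • T.theta = T.const (-1) * T.theta)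
    (ι' : PiTpχ p ≃ₜ* PiTpχ p)
    (hι' : ∀ x, ι' x = (SemidirectProduct.inl γ : PiTpχ p) * invχ p x * (SemidirectProduct.inl γ)⁻¹) :
    ¬ ∃ ιFn : T.Fn →* T.Fn,
      (letI := T.instAction; ∀ (g : (ThetaSetting.modelχ p).PiTemp) (f : T.Fn),
        ιFn (g • f) = (ι' : (ThetaSetting.modelχ p).PiTemp ≃ₜ* (ThetaSetting.modelχ p).PiTemp) g • ιFn f) ∧
      (∀ ζ : cyclotome T.Fn, cyclotome.map ιFn ζ = ζ) ∧ ιFn T.theta = T.theta := by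
  intro hP
  obtain ⟨hεY, hεdd⟩ := inl_bPowGfp_eta_one_mem_GtpY_not_mem_GtpYdd p
  -- the conjugated lift `Ad(inl(b·γ)) ∘ ι`, a vertex-`0` inner lift
  obtain ⟨ι'', hι''⟩ : ∃ ι'' : PiTpχ p ≃ₜ* PiTpχ p, ∀ x,
      ι'' x = (SemidirectProduct.inl (bPowGfp (ZHatLevel.eta 1) * γ) : PiTpχ p) * invχ p x *
        (SemidirectProduct.inl (bPowGfp (ZHatLevel.eta 1) * γ))⁻¹ :=
    ⟨(invχ p).trans
      { toMulEquiv := MulAut.conj (SemidirectProduct.inl (bPowGfp (ZHatLevel.eta 1) * γ) : PiTpχ p)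
        continuous_toFun := by
          change Continuous fun x : PiTpχ p => (SemidirectProduct.inl (bPowGfp (ZHatLevel.eta 1) * γ) : PiTpχ p) *
            x * (SemidirectProduct.inl (bPowGfp (ZHatLevel.eta 1) * γ))⁻¹
          exact (continuous_const.mul continuous_id).mul continuous_const
        continuous_invFun := by
          change Continuous fun x : PiTpχ p => (SemidirectProduct.inl (bPowGfp (ZHatLevel.eta 1) * γ) : PiTpχ p)⁻¹ *
            x * SemidirectProduct.inl (bPowGfp (ZHatLevel.eta 1) * γ)
          exact (continuous_const.mul continuous_id).mul continuous_const }, fun _ => rfl⟩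
  have hrel : ∀ x, ι'' x = (SemidirectProduct.inl (bPowGfp (ZHatLevel.eta 1)) : PiTpχ p) * ι' x *
      (SemidirectProduct.inl (bPowGfp (ZHatLevel.eta 1)))⁻¹ := fun x => by
    rw [hι'', hι', map_mul]
    group
  have hγ' : (SemidirectProduct.inl (bPowGfp (ZHatLevel.eta 1) * γ) : PiTpχ p) ∈ (ThetaSetting.modelχ p).GtpY := by
    rw [map_mul]
    exact mul_mem hεY hγ
  exact not_exists_package_modelχ_innerLift_of_constCompat p _ hγ' T hinj hcc ι'' hι''
    (T.exists_package_conj_deck_of_exists_packagePlus hinj hεY hεdd rfl hdeck ι' ι'' hrel hP)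

end SettingModel

end Literature.AnabelianGeometry.EtaleTheta

end
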